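import Literature.Probability.RandomPlanarGeometry.HexSAWSurfaceFourthOrderLower
import Literature.Probability.RandomPlanarGeometry.HexSAWSurfaceFourthOrderUpper
import Literature.Probability.RandomPlanarGeometry.HexSAWSurfaceFifthOrderLower
import HarnessLib

/-!
# Honeycomb SAW at the Duminil-Copin–Smirnov surface (brick-wall frame): the FOURTH coefficient of the adsorbed-phase expansion is EXACTLY 2 —
# `y³ (β(y)² − y − 1/y − 1/y²) → 2`, i.e. `β(y)² = μ(y)² = y + 1/y + 1/y² + 2/y³ + O(y⁻⁴)`

Topic `Literature/Probability/RandomPlanarGeometry` (lane «pcv-sawmu», car «WALL-FOURTH-ORDER-EXACT», a-p6 g16).  Assembly of the same seat's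
`HexSAWSurfaceFourthOrderLower.lean` (`fourth_lower_sharp : y + 1/y + 1/y² + 2/y³ − 192476/y⁴ ≤ β(y)²`, `y ≥ 1`, by direct concatenation of
left-proper seeds) and `HexSAWSurfaceFourthOrderUpper.lean` (`wallRate_sq_le_fourth : β(y)² ≤ y + 1/y + 1/y² + 2/y³ + 708591/y⁴`, `y ≥ 36`, by
five-step-extendable arches), plus the unconditional form of `HexSAWSurfaceFifthOrderLower.lean`'s conditional fifth-order bound
(`four_sub_div_le_of_window` with the upper car's `C = 708591`): `liminf_{y→∞} y⁴ (β(y)² − y − 1/y − 1/y² − 2/y³) ≥ 4`.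

Sources.  BBdGDCG, CMP 326 (2014) = arXiv:1109.0358v5, §3.1, Proposition 5 (p. 9) and the first-order remark p. 10; E. J. Janse van Rensburg (OUP 2000),
§3.3.2, Lemma 3.20; N. Madras, G. Slade (1993), §1.2.

## What is proved (namespace `…SAW.HexBW.Wall`)

* `wallRate_sq_fourth_mem_Icc (36 ≤ y) : β(y)² − y − 1/y − 1/y² − 2/y³ ∈ [−192476/y⁴, 708591/y⁴]`,
  `cube_mul_wallRate_sq_sub_sub_mem_Icc (36 ≤ y) : y³ (β² − y − 1/y − 1/y²) ∈ [2 − 192476/y, 2 + 708591/y]`;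
* ★★★ **`tendsto_cube_mul_wallRate_sq_sub_sub : y³ (β(y)² − y − 1/y − 1/y²) → 2`**, `isBigO_wallRate_sq_fourth :
  β² − y − 1/y − 1/y² − 2/y³ = O(y⁻⁴)`;
* the same for BBdGDCG's `μ(y) = HV.surfaceMu y`: ★★★ `tendsto_cube_mul_surfaceMu_sq_sub_sub`, `surfaceMu_sq_fourth_mem_Icc`;
* ★★ `four_sub_div_le_pow_four_mul (36 ≤ y) : 4 − 53853213/y ≤ y⁴ (β² − y − 1/y − 1/y² − 2/y³)` and `eventually_le_pow_four_mul_wallRate (a < 4)`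
  (liminf ≥ 4 — the census value of the FIFTH coefficient, from below), with the `μ(y)` twin.

HONEST LABEL.  COROLLARY/PACKAGING (XS) of the two parents; the sentence for the REPORT: **μ(y)² = y + 1/y + 1/y² + 2/y³ + O(y⁻⁴)** for the BBdGDCG
surface-fugacity model (zig-zag wall) — the first FOUR finite-fugacity corrections of the adsorbed phase have coefficients 1, 1, 1, 2 (census
conjecture for the next two: 4, 6; the `≥ 4` half of the first is proved here).  Print: first order only (BBdGDCG p. 10).
-/

noncomputable section

open Filter Function
open _root_.Topology

namespace Literature.Probability.RandomPlanarGeometry.SAW.HexBW.Wall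

variable {y : ℝ}

/-- ★★ **THE FOURTH-ORDER WINDOW** (`y ≥ 36`): `β(y)² − y − 1/y − 1/y² − 2/y³ ∈ [−192476/y⁴, 708591/y⁴]`.
[cite: BeatonBousquetMelouDeGierDuminilCopinGuttmann2014, §3.1, Proposition 5 (arXiv v5 p. 9); p. 10 (first-order remark)] [cite: JansevanRensburg2000, §3.3.2, Lemma 3.20] -/
theorem wallRate_sq_fourth_mem_Icc (hy : 36 ≤ y) :
    wallRate y ^ 2 - y - 1 / y - 1 / y ^ 2 - 2 / y ^ 3 ∈ Set.Icc (-(192476 / y ^ 4)) (708591 / y ^ 4) := by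
  have h1 := fourth_lower_sharp (show (1 : ℝ) ≤ y by linarith)
  have h2 := wallRate_sq_le_fourth hy
  constructor <;> linarith

/-- ★★ **`y³ (β(y)² − y − 1/y − 1/y²) ∈ [2 − 192476/y, 2 + 708591/y]`** (`y ≥ 36`).
[cite: BeatonBousquetMelouDeGierDuminilCopinGuttmann2014, §3.1, Proposition 5 (arXiv v5 p. 9); p. 10 (first-order remark)] [cite: JansevanRensburg2000, §3.3.2, Lemma 3.20] -/
theorem cube_mul_wallRate_sq_sub_sub_mem_Icc (hy : 36 ≤ y) :
    y ^ 3 * (wallRate y ^ 2 - y - 1 / y - 1 / y ^ 2) ∈ Set.Icc (2 - 192476 / y) (2 + 708591 / y) :=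
  ⟨two_sub_div_le_cube_mul (by linarith), cube_mul_wallRate_sq_sub_le hy⟩

/-- ★★★ **THE FOURTH COEFFICIENT IS EXACTLY TWO: `y³ (β(y)² − y − 1/y − 1/y²) → 2`** as `y → ∞`.
[cite: BeatonBousquetMelouDeGierDuminilCopinGuttmann2014, §3.1, Proposition 5 (arXiv v5 p. 9); p. 10 (first-order remark)] [cite: JansevanRensburg2000, §3.3.2, Lemma 3.20] -/
theorem tendsto_cube_mul_wallRate_sq_sub_sub :
    Tendsto (fun y : ℝ => y ^ 3 * (wallRate y ^ 2 - y - 1 / y - 1 / y ^ 2)) atTop (𝓝 2) := by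
  have hlow : Tendsto (fun y : ℝ => 2 - 192476 / y) atTop (𝓝 2) := by
    have h := (tendsto_const_nhds (x := (192476 : ℝ))).div_atTop tendsto_id
    simpa using (tendsto_const_nhds (x := (2 : ℝ))).sub h
  have hup : Tendsto (fun y : ℝ => 2 + 708591 / y) atTop (𝓝 2) := by
    have h := (tendsto_const_nhds (x := (708591 : ℝ))).div_atTop tendsto_id
    simpa using (tendsto_const_nhds (x := (2 : ℝ))).add h
  refine tendsto_of_tendsto_of_tendsto_of_le_of_le' hlow hup ?_ ?_
  · filter_upwards [eventually_ge_atTop (36 : ℝ)] with y hy using (cube_mul_wallRate_sq_sub_sub_mem_Icc hy).1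
  · filter_upwards [eventually_ge_atTop (36 : ℝ)] with y hy using (cube_mul_wallRate_sq_sub_sub_mem_Icc hy).2

/-- ★★ **`β(y)² − y − 1/y − 1/y² − 2/y³ = O(y⁻⁴)`** (`y → ∞`). [cite: BeatonBousquetMelouDeGierDuminilCopinGuttmann2014, §3.1, Proposition 5 (arXiv v5 p. 9); p. 10 (first-order remark)] [cite: JansevanRensburg2000, §3.3.2, Lemma 3.20] -/
theorem isBigO_wallRate_sq_fourth :
    (fun y : ℝ => wallRate y ^ 2 - y - 1 / y - 1 / y ^ 2 - 2 / y ^ 3) =O[atTop] (fun y : ℝ => (y ^ 4)⁻¹) := by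
  refine Asymptotics.IsBigO.of_bound 708591 ?_
  filter_upwards [eventually_ge_atTop (36 : ℝ)] with y hy
  have hy0 : 0 < y := by linarith
  obtain ⟨h1, h2⟩ := wallRate_sq_fourth_mem_Icc hy
  rw [Real.norm_eq_abs, Real.norm_eq_abs, abs_of_pos (by positivity : (0 : ℝ) < (y ^ 4)⁻¹), abs_le]
  constructor
  · have : (192476 : ℝ) / y ^ 4 ≤ 708591 * (y ^ 4)⁻¹ := by
      rw [div_eq_mul_inv]; exact mul_le_mul_of_nonneg_right (by norm_num) (by positivity)
    linarith
  · rw [div_eq_mul_inv] at h2; exact h2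

/-- ★★★ **`y³ (μ(y)² − y − 1/y − 1/y²) → 2`** for BBdGDCG's surface growth rate `μ(y) = HV.surfaceMu y`.
[cite: BeatonBousquetMelouDeGierDuminilCopinGuttmann2014, §3.1, Proposition 5 (arXiv v5 p. 9); p. 10 (first-order remark)] [cite: JansevanRensburg2000, §3.3.2, Lemma 3.20] -/
theorem tendsto_cube_mul_surfaceMu_sq_sub_sub :
    Tendsto (fun y : ℝ => y ^ 3 * (HV.surfaceMu y ^ 2 - y - 1 / y - 1 / y ^ 2)) atTop (𝓝 2) := by
  refine tendsto_cube_mul_wallRate_sq_sub_sub.congr' ?_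
  filter_upwards [eventually_gt_atTop (0 : ℝ)] with y hy
  rw [HV.wallRate_eq_surfaceMu hy]

/-- ★★ **`μ(y)² − y − 1/y − 1/y² − 2/y³ ∈ [−192476/y⁴, 708591/y⁴]`** (`y ≥ 36`).
[cite: BeatonBousquetMelouDeGierDuminilCopinGuttmann2014, §3.1, Proposition 5 (arXiv v5 p. 9); p. 10 (first-order remark)] [cite: JansevanRensburg2000, §3.3.2, Lemma 3.20] -/
theorem surfaceMu_sq_fourth_mem_Icc (hy : 36 ≤ y) :
    HV.surfaceMu y ^ 2 - y - 1 / y - 1 / y ^ 2 - 2 / y ^ 3 ∈ Set.Icc (-(192476 / y ^ 4)) (708591 / y ^ 4) := by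
  rw [← HV.wallRate_eq_surfaceMu (by linarith)]
  exact wallRate_sq_fourth_mem_Icc hy

/-- ★★ **THE FIFTH COEFFICIENT FROM BELOW, unconditionally**: `4 − 53853213/y ≤ y⁴ (β(y)² − y − 1/y − 1/y² − 2/y³)` for `y ≥ 36`
(`53853213 = 297 + 76·708591`). [cite: JansevanRensburg2000, §3.3.2, Lemma 3.20] [cite: BeatonBousquetMelouDeGierDuminilCopinGuttmann2014, §3.1 (arXiv v5 p. 10: first-order remark)] -/
theorem four_sub_div_le_pow_four_mul (hy : 36 ≤ y) :
    4 - 53853213 / y ≤ y ^ 4 * (wallRate y ^ 2 - y - 1 / y - 1 / y ^ 2 - 2 / y ^ 3) := by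
  have h := four_sub_div_le_of_window (show (1 : ℝ) ≤ y by linarith) (C := 708591) (by norm_num) (wallRate_sq_le_fourth hy)
  have e : (297 + 76 * 708591 : ℝ) = 53853213 := by norm_num
  rw [e] at h
  exact h

/-- ★★ **`liminf_{y→∞} y⁴ (β(y)² − y − 1/y − 1/y² − 2/y³) ≥ 4`** (elementary form). [cite: JansevanRensburg2000, §3.3.2, Lemma 3.20] [cite: BeatonBousquetMelouDeGierDuminilCopinGuttmann2014, §3.1 (arXiv v5 p. 10: first-order remark)] -/
theorem eventually_le_pow_four_mul_wallRate {a : ℝ} (ha : a < 4) :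
    ∀ᶠ y : ℝ in atTop, a ≤ y ^ 4 * (wallRate y ^ 2 - y - 1 / y - 1 / y ^ 2 - 2 / y ^ 3) := by
  have h1 : ∀ᶠ y : ℝ in atTop, 36 ≤ y := eventually_ge_atTop 36
  have h2 : ∀ᶠ y : ℝ in atTop, 53853213 / (4 - a) ≤ y := eventually_ge_atTop _
  filter_upwards [h1, h2] with y hy hy2
  have hy0 : 0 < y := by linarith
  have h := four_sub_div_le_pow_four_mul hy
  have h3 : 53853213 / y ≤ 4 - a := by
    rw [div_le_iff₀ hy0]
    have := (div_le_iff₀ (by linarith : (0:ℝ) < 4 - a)).1 hy2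
    linarith
  linarith

/-- ★★ **`liminf_{y→∞} y⁴ (μ(y)² − y − 1/y − 1/y² − 2/y³) ≥ 4`** for BBdGDCG's `μ(y)`. [cite: BeatonBousquetMelouDeGierDuminilCopinGuttmann2014, §3.1, Proposition 5 (arXiv v5 p. 9); p. 10 (first-order remark)] [cite: JansevanRensburg2000, §3.3.2, Lemma 3.20] -/
theorem eventually_le_pow_four_mul_surfaceMu {a : ℝ} (ha : a < 4) :
    ∀ᶠ y : ℝ in atTop, a ≤ y ^ 4 * (HV.surfaceMu y ^ 2 - y - 1 / y - 1 / y ^ 2 - 2 / y ^ 3) := by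
  filter_upwards [eventually_le_pow_four_mul_wallRate ha, eventually_gt_atTop 0] with y h hy0
  rwa [HV.wallRate_eq_surfaceMu hy0] at h

end Literature.Probability.RandomPlanarGeometry.SAW.HexBW.Wall
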